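import Mathlib.LinearAlgebra.Matrix.NonsingularInverse
import Mathlib.Data.List.GetD
import Literature.Computability.AlgebraicComplexity.MS21DenseOrbitsHittingSets
import Literature.RingTheory.Nullstellensatz.PerronTheorem
import HarnessLib

/-!
# Medini–Shpilka 2021, Thm 42 (inclusions): `T^{GLaff}(F) ⊊ ΣΠ^{GLaff}(F) ⊆ ΣΠΣ(F)` — proofs

Discharge of the named fact `MS2021_thm_42_incl` of
`Literature/Computability/AlgebraicComplexity/MS21DenseOrbitsHittingSets.lean` (cell `val-lit`,
seat x6): `theorem MS2021_thm_42_incl_holds : MS2021_thm_42_incl`, by the printed argument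
(Medini–Shpilka, CCC 2021 = arXiv:2102.05632, §6 "Proof of Theorem 1.26", arXiv p0034:L5-L9) with
the elementary tools it presupposes made explicit:

* **Affine substitutions** `f ↦ f(Ax + b)` (`MS2021.affSubst`): they never raise the total degree
  (`totalDegree_affSubst_le`), and for `A ∈ GL_n` they PRESERVE it (`totalDegree_affSubst`) —
  "as we compose with invertible affine maps" (p0034:L8): the substitution `(A⁻¹, -A⁻¹ b)` is a
  left inverse of the substitution `(A, b)` on `F[x_1..x_n]` (`aeval_affine_inv_apply`).
* **`T^{GLaff} ⊆ ΣΠ^{GLaff}`**: `T_{s,d}` (`MS2021.sdm`) has at most `s` monomials (at most `1` if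
  `d = 0`) and degree `≤ d` (`card_support_sdm_le_succ`, `totalDegree_sdm_le_mul`), so at level `n`
  the printed witness circuit is `T_{s,d}` itself, with `m(n) = n + 1`.
* **`T^{GLaff} ≠ ΣΠ^{GLaff}`**: the printed witness family `f_n = x_1²` (p0034:L8). The paper shows
  `x_1² ∉ T^{GLaff}` at every level via the inverse map and non-multilinearity of `ℓ(x)²`; here the
  shorter road is taken (disclosed deviation): at level `n = 1` the constraint `s·d ≤ n` forces
  `deg T_{s,d}(Ax+b) ≤ deg T_{s,d} ≤ s·d ≤ 1 < 2 = deg x_1²` (`totalDegree_affSubst_le`).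
* **`ΣΠ^{GLaff} ⊆ ΣΠΣ`** ("Clearly, `T_{s,d}^{GLaff_n(F)} ⊂ Σ^{[s]}Π^{[d]}Σ`", arXiv p0008:L55, and the
  same expansion for any `s`-sparse `g` of degree `≤ d`): substituting affine forms into the
  `≤ s` monomials of `g` and padding with the affine forms `1`, `0` writes `g(Ax+b)` as a
  `Σ^{[s]}Π^{[d+1]}Σ` circuit (`isSPS_aeval_affine`; slot `0` of each product gate carries the
  coefficient).

Theorem-only file: no definition, no new named fact (D-0026); `VP ≠ VNP` is NOT proved and nothing
here bears on it beyond discharging a typed literature statement by name.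

## References
* [MediniShpilka2021] D. Medini, A. Shpilka, CCC 2021, LIPIcs 200:19, Thm 42 (= arXiv:2102.05632
  Thm 1.26, p0008:L63-L78; proof §6, p0034:L5-L9).
-/

noncomputable section

open MvPolynomial Matrix

namespace Literature.Computability.AlgebraicComplexity

namespace MS2021

/-! ### Affine substitutions: degree bound, inverse substitution, degree preservation -/

section Affine

variable {K : Type*} [Field K] {m n : ℕ}

/-- An affine form `∑_j a_j x_j + c` (a bottom `Σ` gate of a `ΣΠΣ` circuit, Def 4) has total degree
`≤ 1`. [cite: MediniShpilka2021, Def 4 (CCC p.19:6; arXiv ‹Def 1.4› p0005:L25-L30)] -/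
theorem totalDegree_affineForm_le_one (a : Fin n → K) (c : K) :
    ((∑ j, C (a j) * X j) + C c : MvPolynomial (Fin n) K).totalDegree ≤ 1 := by
  refine (totalDegree_add _ _).trans (max_le ?_ ?_)
  · refine totalDegree_finsetSum_le fun j _ => (totalDegree_mul _ _).trans ?_
    rw [totalDegree_C, totalDegree_X, zero_add]
  · rw [totalDegree_C]; exact Nat.zero_le _

/-- `deg f(Ax + b) ≤ deg f` for every matrix `A` and vector `b`.
[cite: MediniShpilka2021, §1.1.6 eq. (2) (CCC p.19:9; arXiv p0007:L7-L10)] -/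
theorem totalDegree_affSubst_le (h : m ≤ n) (A : Matrix (Fin n) (Fin n) K) (b : Fin n → K)
    (f : MvPolynomial (Fin m) K) : (affSubst h A b f).totalDegree ≤ f.totalDegree := by
  have key := Literature.RingTheory.Nullstellensatz.totalDegree_aeval_le
    (fun i : Fin m => (∑ j : Fin n, C (A (Fin.castLE h i) j) * X j) + C (b (Fin.castLE h i)))
    (δ := 1) (fun i => totalDegree_affineForm_le_one _ _) f
  rw [mul_one] at key
  exact key

/-- `f(Ax + b)` is the FULL affine substitution `x_i ↦ ∑_j A_{ij} x_j + b_i` (`i ≤ n`) applied to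
`f` regarded as an `n`-variate polynomial. [cite: MediniShpilka2021, §1.1.6 eq. (2) (CCC p.19:9)] -/
theorem affSubst_eq_aeval_rename (h : m ≤ n) (A : Matrix (Fin n) (Fin n) K) (b : Fin n → K)
    (f : MvPolynomial (Fin m) K) :
    affSubst h A b f =
      aeval (fun i : Fin n => (∑ j, C (A i j) * X j) + C (b i)) (rename (Fin.castLE h) f) := by
  rw [affSubst, aeval_rename]
  rfl

/-- The full affine substitution `(A', b')` maps the affine form `a·x + c` to
`(a A')·x + (a·b' + c)` (composition of affine maps, the group law of `GLaff_n(F)`).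
[cite: MediniShpilka2021, §1.1.6 (CCC p.19:9; arXiv p0007:L7-L18)] -/
theorem aeval_affine_affineForm (A' : Matrix (Fin n) (Fin n) K) (b' : Fin n → K)
    (a : Fin n → K) (c : K) :
    aeval (fun i : Fin n => (∑ j, C (A' i j) * X j) + C (b' i))
        ((∑ j, C (a j) * X j) + C c : MvPolynomial (Fin n) K) =
      (∑ k, C ((a ᵥ* A') k) * X k) + C (a ⬝ᵥ b' + c) := by
  simp only [map_add, map_sum, map_mul, aeval_C, aeval_X, algebraMap_eq, Matrix.vecMul,
    dotProduct, mul_add, Finset.sum_add_distrib, Finset.mul_sum, add_assoc]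
  congr 1
  rw [Finset.sum_comm]
  refine Finset.sum_congr rfl fun k _ => ?_
  rw [Finset.sum_mul]
  refine Finset.sum_congr rfl fun j _ => ?_
  rw [mul_assoc]

/-- `∑_k 1_{ik} x_k = x_i`. [folklore] -/
private theorem sum_C_one_apply_mul_X (i : Fin n) :
    ∑ k : Fin n, C ((1 : Matrix (Fin n) (Fin n) K) i k) * X k = (X i : MvPolynomial (Fin n) K) := by
  rw [Finset.sum_eq_single i]
  · simp
  · intro k _ hk
    rw [Matrix.one_apply_ne' hk, C_0, zero_mul]
  · intro h
    exact absurd (Finset.mem_univ i) h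

/-- **The inverse substitution**: for `A ∈ GL_n(F)` the full affine substitution
`(A⁻¹, -A⁻¹ b)` is a left inverse of the full affine substitution `(A, b)` ("as we compose with
invertible affine maps"). [cite: MediniShpilka2021, §6 proof of Thm 42 (arXiv p0034:L8)] -/
theorem aeval_affine_inv_apply {A : Matrix (Fin n) (Fin n) K} (hA : IsUnit A.det)
    (b : Fin n → K) (p : MvPolynomial (Fin n) K) :
    aeval (fun i : Fin n => (∑ j, C (A⁻¹ i j) * X j) + C ((-(A⁻¹ *ᵥ b)) i))
      (aeval (fun i : Fin n => (∑ j, C (A i j) * X j) + C (b i)) p) = p := by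
  rw [← AlgHom.comp_apply, comp_aeval]
  have key : (fun i : Fin n =>
      aeval (fun i : Fin n => (∑ j, C (A⁻¹ i j) * X j) + C ((-(A⁻¹ *ᵥ b)) i))
        ((∑ j, C (A i j) * X j) + C (b i))) = X := by
    funext i
    rw [aeval_affine_affineForm]
    have h1 : A i ᵥ* A⁻¹ = (1 : Matrix (Fin n) (Fin n) K) i := by
      funext k
      rw [← Matrix.mul_nonsing_inv A hA, Matrix.mul_apply]
      simp [Matrix.vecMul, dotProduct]
    have h3 : A *ᵥ (A⁻¹ *ᵥ b) = b := by
      rw [Matrix.mulVec_mulVec, Matrix.mul_nonsing_inv A hA, Matrix.one_mulVec]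
    have h4 : A i ⬝ᵥ (A⁻¹ *ᵥ b) = b i := congrFun h3 i
    have h2 : A i ⬝ᵥ (-(A⁻¹ *ᵥ b)) + b i = 0 := by
      rw [dotProduct_neg, h4, neg_add_cancel]
    rw [h1, h2, C_0, add_zero, sum_C_one_apply_mul_X]
  rw [key, aeval_X_left, AlgHom.id_apply]

/-- Renaming along `Fin.castLE` does not lower the total degree (it preserves it). [folklore] -/
private theorem totalDegree_le_totalDegree_rename_castLE (h : m ≤ n) (f : MvPolynomial (Fin m) K) :
    f.totalDegree ≤ (rename (Fin.castLE h) f).totalDegree := by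
  classical
  refine Finset.sup_le fun s hs => ?_
  have hinj : Function.Injective (Fin.castLE h) := Fin.castLE_injective h
  have hmem : Finsupp.mapDomain (Fin.castLE h) s ∈ (rename (Fin.castLE h) f).support := by
    rw [support_rename_of_injective hinj]
    exact Finset.mem_image_of_mem _ hs
  have hdeg : ((Finsupp.mapDomain (Fin.castLE h) s).sum fun _ k => k) = s.sum fun _ k => k :=
    Finsupp.sum_mapDomain_index_inj hinj
  rw [← hdeg]
  exact le_totalDegree hmem

/-- **Invertible affine substitutions preserve the total degree**: `deg f(Ax+b) = deg f` for
`A ∈ GL_n(F)`. [cite: MediniShpilka2021, §6 proof of Thm 42 (arXiv p0034:L8)] -/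
theorem totalDegree_affSubst (h : m ≤ n) {A : Matrix (Fin n) (Fin n) K} (hA : IsUnit A.det)
    (b : Fin n → K) (f : MvPolynomial (Fin m) K) :
    (affSubst h A b f).totalDegree = f.totalDegree := by
  refine le_antisymm (totalDegree_affSubst_le h A b f) ?_
  have key := Literature.RingTheory.Nullstellensatz.totalDegree_aeval_le
    (fun i : Fin n => (∑ j, C (A⁻¹ i j) * X j) + C ((-(A⁻¹ *ᵥ b)) i)) (δ := 1)
    (fun i => totalDegree_affineForm_le_one _ _) (affSubst h A b f)
  rw [mul_one, affSubst_eq_aeval_rename, aeval_affine_inv_apply hA] at key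
  rw [affSubst_eq_aeval_rename]
  exact (totalDegree_le_totalDegree_rename_castLE h f).trans key

/-- `f(1·x + 0) = f`: the identity of `GLaff_n(F)` acts trivially.
[cite: MediniShpilka2021, §1.1.6 (CCC p.19:9; arXiv p0007:L7-L18)] -/
theorem affSubst_one_zero (f : MvPolynomial (Fin n) K) : affSubst le_rfl 1 0 f = f := by
  have hfun : (fun i : Fin n => (∑ j : Fin n, C ((1 : Matrix (Fin n) (Fin n) K) (Fin.castLE le_rfl i) j)
      * X j) + C ((0 : Fin n → K) (Fin.castLE le_rfl i))) = X := by
    funext i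
    rw [Fin.castLE_refl, Pi.zero_apply, C_0, add_zero, sum_C_one_apply_mul_X]
  unfold affSubst
  rw [hfun, aeval_X_left_apply]

/-- Every `n`-variate polynomial lies in its own `GLaff_n`-orbit (`(1, 0) ∈ GLaff_n(F)`).
[cite: MediniShpilka2021, §1.1.6 (CCC p.19:9 "f^{GLaff_n(F)} ≜ {f(Ax+b) | A ∈ GL_n(F), b ∈ F^n}"; arXiv p0007:L16-L18)] -/
theorem mem_affOrbit_self (f : MvPolynomial (Fin n) K) : f ∈ affOrbit n f :=
  ⟨le_rfl, 1, 0, by simp, (affSubst_one_zero f).symm⟩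

end Affine

/-! ### The diagonal tensor `T_{s,d}`: sparsity and degree -/

section Sdm

variable {K : Type*} [Field K]

/-- `T_{s,d}` has at most `s` monomials. [cite: MediniShpilka2021, Def 40 (CCC p.19:13) "a sum of `s` variable disjoint monomials"] -/
theorem card_support_sdm_le (s d : ℕ) : (sdm K s d).support.card ≤ s := by
  classical
  have hsdm : sdm K s d =
      ∑ i : Fin s, monomial (∑ j : Fin d, Finsupp.single (finProdFinEquiv (i, j)) 1) (1 : K) := by
    unfold sdm
    refine Finset.sum_congr rfl fun i _ => ?_
    rw [monomial_sum_one]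
    rfl
  rw [hsdm]
  refine (Finset.card_le_card (support_sum (s := Finset.univ))).trans ?_
  refine Finset.card_biUnion_le.trans ?_
  calc ∑ i : Fin s, (monomial (∑ j : Fin d, Finsupp.single (finProdFinEquiv (i, j)) 1)
          (1 : K)).support.card
      ≤ ∑ _i : Fin s, 1 := Finset.sum_le_sum fun i _ =>
          (Finset.card_le_card (support_monomial_subset)).trans (by simp)
    _ = s := by simp

/-- `T_{s,0} = s` is a constant: at most one monomial (degenerate case of Def 40).
[cite: MediniShpilka2021, Def 40 (CCC p.19:13; arXiv ‹Def 1.24› p0008:L51-L53)] -/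
theorem card_support_sdm_zero_le (s : ℕ) : (sdm K s 0).support.card ≤ 1 := by
  classical
  have hsdm : sdm K s 0 = C (s : K) := by
    simp [sdm]
  rw [hsdm, C_apply]
  exact (Finset.card_le_card support_monomial_subset).trans (by simp)

/-- `T_{s,d}` has at most `s·d + 1` monomials (uniformly in the degenerate cases `s = 0`, `d = 0`).
[cite: MediniShpilka2021, Def 40 (CCC p.19:13; arXiv ‹Def 1.24› p0008:L51-L53)] -/
theorem card_support_sdm_le_succ (s d : ℕ) : (sdm K s d).support.card ≤ s * d + 1 := by
  rcases Nat.eq_zero_or_pos d with rfl | hd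
  · exact (card_support_sdm_zero_le s).trans (by simp)
  · exact (card_support_sdm_le s d).trans
      ((Nat.le_mul_of_pos_right s hd).trans (Nat.le_succ _))

/-- `deg T_{s,d} ≤ d`. [cite: MediniShpilka2021, Def 40 (CCC p.19:13)] -/
theorem totalDegree_sdm_le (s d : ℕ) : (sdm K s d).totalDegree ≤ d := by
  unfold sdm
  refine totalDegree_finsetSum_le fun i _ => (totalDegree_finsetProd _ _).trans ?_
  simp

/-- `deg T_{s,d} ≤ s·d` (`T_{0,d} = 0`), the form used with the side condition `n ≥ s·d` of
`T^{GLaff}`. [cite: MediniShpilka2021, Def 40 (CCC p.19:13; arXiv ‹Def 1.24› p0008:L51-L55)] -/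
theorem totalDegree_sdm_le_mul (s d : ℕ) : (sdm K s d).totalDegree ≤ s * d := by
  rcases Nat.eq_zero_or_pos s with rfl | hs
  · simp [sdm]
  · exact (totalDegree_sdm_le s d).trans (Nat.le_mul_of_pos_left d hs)

end Sdm

/-! ### Expanding a sparse polynomial composed with affine forms into a `ΣΠΣ` circuit -/

section Expansion

variable {K : Type*} [Field K] {n : ℕ}

/-- `∏_{j < d} L[j]` (entries past the end read as `1`) is the product of the list `L` when
`|L| ≤ d`. [folklore] -/
private theorem prod_univ_getD_one {M : Type*} [CommMonoid M] :
    ∀ (L : List M) (d : ℕ), L.length ≤ d → ∏ j : Fin d, L.getD j 1 = L.prod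
  | [], d, _ => by simp
  | a :: L, 0, h => by simp at h
  | a :: L, d + 1, h => by
      rw [Fin.prod_univ_succ, List.prod_cons]
      simp only [Fin.val_zero, List.getD_cons_zero, Fin.val_succ, List.getD_cons_succ]
      rw [prod_univ_getD_one L d (by simpa using h)]

/-- `∑_{j < s} L[j]` (entries past the end read as `0`) is the sum of the list `L` when
`|L| ≤ s`. [folklore] -/
private theorem sum_univ_getD_zero {N : Type*} [AddCommMonoid N] :
    ∀ (L : List N) (s : ℕ), L.length ≤ s → ∑ j : Fin s, L.getD j 0 = L.sum
  | [], s, _ => by simp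
  | a :: L, 0, h => by simp at h
  | a :: L, s + 1, h => by
      rw [Fin.sum_univ_succ, List.sum_cons]
      simp only [Fin.val_zero, List.getD_cons_zero, Fin.val_succ, List.getD_cons_succ]
      rw [sum_univ_getD_zero L s (by simpa using h)]

/-- **Sparse polynomials composed with affine forms are `ΣΠΣ` circuits**: if `g ∈ F[y_1..y_k]` has at
most `s` monomials and degree `≤ d`, then `g(ℓ_1(x), …, ℓ_k(x))`, for affine forms `ℓ_i` in
`x_1..x_n` (coefficient vectors `β i`), is computed by a `Σ^{[s]}Π^{[d+1]}Σ` circuit (one product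
gate per monomial, one slot for its coefficient, `d` slots for the affine forms of its variables
padded with `1`; unused product gates are `0`). [cite: MediniShpilka2021, §1.2.3 "Clearly, T_{s,d}^{GLaff_n(F)} ⊂ Σ^{[s]}Π^{[d]}Σ" (CCC p.19:13; arXiv p0008:L55)] -/
theorem isSPS_aeval_affine {k s d : ℕ} (g : MvPolynomial (Fin k) K) (hs : g.support.card ≤ s)
    (hd : g.totalDegree ≤ d) (β : Fin k → Option (Fin n) → K) :
    IsSPS s (d + 1)
      (aeval (fun i => C (β i none) + ∑ l : Fin n, C (β i (some l)) * X l) g) := by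
  classical
  -- the affine form with coefficient vector `γ`
  let aff : (Option (Fin n) → K) → MvPolynomial (Fin n) K :=
    fun γ => C (γ none) + ∑ l : Fin n, C (γ (some l)) * X l
  have aff_apply : ∀ γ, aff γ = C (γ none) + ∑ l : Fin n, C (γ (some l)) * X l := fun γ => rfl
  -- the constant forms `c` (in particular `1`) and the zero form
  let cst : K → Option (Fin n) → K := fun c o => o.elim c fun _ => 0
  have aff_cst : ∀ c, aff (cst c) = C c := fun c => by simp [aff, cst]
  have aff_zero : aff 0 = 0 := by simp [aff]
  -- value of a `(d+1)`-tuple of coefficient vectors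
  let val : (Fin (d + 1) → Option (Fin n) → K) → MvPolynomial (Fin n) K :=
    fun τ => ∏ j, aff (τ j)
  have val_zero : val 0 = 0 := by
    show ∏ j : Fin (d + 1), aff ((0 : Fin (d + 1) → Option (Fin n) → K) j) = 0
    rw [Fin.prod_univ_succ]
    simp [aff_zero]
  -- the product gate of a monomial `e` with coefficient `c`
  let slots : (Fin k →₀ ℕ) → List (Option (Fin n) → K) :=
    fun e => e.support.toList.flatMap fun i => List.replicate (e i) (β i)
  have slots_length : ∀ e ∈ g.support, (slots e).length ≤ d := by
    intro e he
    have h1 : (slots e).length = ∑ i ∈ e.support, e i := by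
      simp only [slots, List.length_flatMap, List.length_replicate]
      rw [← Finset.sum_map_toList e.support (fun i => e i)]
    rw [h1]
    exact (le_totalDegree he).trans hd
  have slots_prod : ∀ e, ((slots e).map aff).prod = e.prod fun i r => aff (β i) ^ r := by
    intro e
    simp only [slots, List.flatMap_def, List.map_flatten, List.map_map, List.prod_flatten]
    rw [Finsupp.prod, ← Finset.prod_map_toList]
    simp [Function.comp_def, List.prod_replicate]
  let gate : (Fin k →₀ ℕ) → Fin (d + 1) → Option (Fin n) → K :=
    fun e => Fin.cons (cst (coeff e g)) fun j => (slots e).getD j (cst 1)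
  have val_gate : ∀ e ∈ g.support, val (gate e) = aeval (fun i => aff (β i)) (monomial e (coeff e g)) := by
    intro e he
    show ∏ j : Fin (d + 1), aff (gate e j) = _
    rw [Fin.prod_univ_succ]
    simp only [gate, Fin.cons_zero, Fin.cons_succ, aff_cst]
    rw [aeval_monomial, algebraMap_eq, ← slots_prod e,
      ← prod_univ_getD_one _ d (by simpa using slots_length e he)]
    refine congrArg _ (Finset.prod_congr rfl fun j _ => ?_)
    rw [show (1 : MvPolynomial (Fin n) K) = aff (cst 1) by rw [aff_cst, C_1], List.getD_map]
  -- all product gates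
  let gates : List (Fin (d + 1) → Option (Fin n) → K) := g.support.toList.map gate
  have gates_length : gates.length ≤ s := by simpa [gates] using hs
  refine ⟨fun i => gates.getD i 0, ?_⟩
  show _ = ∑ i : Fin s, val (gates.getD i 0)
  have hsum : ∑ i : Fin s, val (gates.getD i 0) = (gates.map val).sum := by
    rw [← sum_univ_getD_zero _ s (by simpa using gates_length)]
    refine Finset.sum_congr rfl fun i _ => ?_
    rw [← val_zero, List.getD_map]
  rw [hsum]
  simp only [gates, List.map_map]
  rw [Finset.sum_map_toList]
  conv_lhs => rw [g.as_sum, map_sum]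
  refine Finset.sum_congr rfl fun e he => ?_
  rw [Function.comp_apply, val_gate e he]

end Expansion

end MS2021

/-! ### The discharge -/

section Discharge

open MS2021

/-- `T^{GLaff}(F) ⊆ ΣΠ^{GLaff}(F)`: at level `n` the witness circuit is `T_{s,d}` itself (`s·d ≤ n`
variables, `≤ s·d + 1 ≤ n + 1` monomials, degree `= deg f_n` by degree preservation).
[cite: MediniShpilka2021, Thm 42 (CCC p.19:14; arXiv Thm 1.26 p0008:L63-L68)] -/
theorem MS2021.tAffClass_subset_sigmaPiAffClass (K : Type) [Field K] :
    TAffClass K ⊆ SigmaPiAffClass K := by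
  intro f hf
  have hdeg : ∀ n, (f n).totalDegree ≤ n := by
    intro n
    obtain ⟨s, d, hsd, h, A, b, -, heq⟩ := hf n
    rw [heq]
    exact (totalDegree_affSubst_le h A b _).trans ((totalDegree_sdm_le_mul s d).trans hsd)
  refine ⟨⟨1, fun n => (hdeg n).trans (by simp)⟩, fun n => n + 1, ⟨1, fun n => by simp⟩,
    fun n => ?_⟩
  obtain ⟨s, d, hsd, hmem⟩ := hf n
  obtain ⟨h, A, b, hA, heq⟩ := id hmem
  refine ⟨s * d, sdm K s d, hsd, (card_support_sdm_le_succ s d).trans (by dsimp only; omega),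
    ?_, hmem⟩
  rw [heq, totalDegree_affSubst h hA]

/-- `T^{GLaff}(F) ≠ ΣΠ^{GLaff}(F)`: the family `(x_1²)_n` (printed witness) is in `ΣΠ^{GLaff}` but
not in `T^{GLaff}` — at level `n = 1`, `s·d ≤ 1` forces `deg T_{s,d}(Ax+b) ≤ 1 < 2`.
[cite: MediniShpilka2021, Thm 42 and §6 proof (arXiv p0034:L8 "the polynomial f(x) = x_1² is in ΣΠ, but not in T^{GLaff}")] -/
theorem MS2021.tAffClass_ne_sigmaPiAffClass (K : Type) [Field K] :
    TAffClass K ≠ SigmaPiAffClass K := by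
  -- the witness family `x_1²` (zero at the empty level `n = 0`)
  let sq : ∀ n, MvPolynomial (Fin n) K := fun n =>
    if hn : 0 < n then X (⟨0, hn⟩ : Fin n) ^ 2 else 0
  have sq_pos : ∀ n (hn : 0 < n), sq n = X (⟨0, hn⟩ : Fin n) ^ 2 := fun n hn => dif_pos hn
  have hmem : sq ∈ SigmaPiAffClass K := by
    refine ⟨⟨2, fun n => ?_⟩, fun _ => 1, IsPBounded.const 1, fun n => ?_⟩
    · show (sq n).totalDegree ≤ n ^ 2 + 2
      rcases Nat.eq_zero_or_pos n with rfl | hn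
      · simp [sq]
      · rw [sq_pos n hn, totalDegree_X_pow]; exact Nat.le_add_left 2 _
    · rcases Nat.eq_zero_or_pos n with rfl | hn
      · refine ⟨0, 0, le_rfl, by simp, by simp, le_rfl, 1, 0, by simp, ?_⟩
        simp [sq, affSubst]
      · refine ⟨n, sq n, le_rfl, ?_, le_rfl, mem_affOrbit_self _⟩
        rw [sq_pos n hn, X_pow_eq_monomial]
        classical
        exact (Finset.card_le_card support_monomial_subset).trans (by simp)
  intro hEq
  rw [← hEq] at hmem
  obtain ⟨s, d, hsd, h, A, b, -, heq⟩ := hmem 1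
  have h2 : (sq 1).totalDegree = 2 := by
    rw [sq_pos 1 Nat.one_pos, totalDegree_X_pow]
  have h1 : (sq 1).totalDegree ≤ 1 := by
    rw [heq]
    exact (totalDegree_affSubst_le h A b _).trans ((totalDegree_sdm_le_mul s d).trans hsd)
  omega

/-- `ΣΠ^{GLaff}(F) ⊆ ΣΠΣ(F)`: expand `g(Ax+b)` monomial by monomial (`isSPS_aeval_affine`), with
top fan-in `m(n)` and product fan-in `deg f_n + 1`.
[cite: MediniShpilka2021, Thm 42 (CCC p.19:14; arXiv Thm 1.26 p0008:L63-L68, "Clearly …" p0008:L55)] -/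
theorem MS2021.sigmaPiAffClass_subset_spsClass (K : Type) [Field K] :
    SigmaPiAffClass K ⊆ SPSClass K := by
  rintro f ⟨hD, m, hm, hf⟩
  refine ⟨m, fun n => (f n).totalDegree + 1, hm,
    IsPBounded.add_holds hD (IsPBounded.const 1), fun n => ?_⟩
  obtain ⟨k, g, -, hs, hd, h, A, b, -, heq⟩ := hf n
  let β : Fin k → Option (Fin n) → K :=
    fun i o => o.elim (b (Fin.castLE h i)) fun l => A (Fin.castLE h i) l
  have hβ : (fun i : Fin k => (∑ j : Fin n, C (A (Fin.castLE h i) j) * X j) + C (b (Fin.castLE h i))) =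
      fun i => C (β i none) + ∑ l : Fin n, C (β i (some l)) * X l := by
    funext i
    simp only [β, Option.elim]
    rw [add_comm]
  have key := isSPS_aeval_affine g hs hd β
  rw [← hβ] at key
  rw [heq]
  exact key

/-- **MS Thm 42 (inclusions), discharged**: `T^{GLaff}(F) ⊊ ΣΠ^{GLaff}(F) ⊆ ΣΠΣ(F)` for every
field `F`. [cite: MediniShpilka2021, Thm 42 (CCC 2021 LIPIcs 200:19, p.19:14; = arXiv:2102.05632 Thm 1.26, p0008:L63-L68; proof §6 p0034:L5-L9)] -/
theorem MS2021_thm_42_incl_holds : MS2021_thm_42_incl := fun K _ =>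
  ⟨MS2021.tAffClass_subset_sigmaPiAffClass K, MS2021.tAffClass_ne_sigmaPiAffClass K,
    MS2021.sigmaPiAffClass_subset_spsClass K⟩

end Discharge

end Literature.Computability.AlgebraicComplexity

end
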